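import Mathlib
import Literature.NumberTheory.LFunctions.Zhang2022.Section16NsetRemovablePrep
import Literature.NumberTheory.LFunctions.Zhang2022.Section16Varpi2WeightSum
import Literature.NumberTheory.LFunctions.Zhang2022.TypedSection16BLocal
import Literature.NumberTheory.LFunctions.Zhang2022.TypedSection15C
import Literature.NumberTheory.LFunctions.Zhang2022.Section3Lemma31
import HarnessLib

/-!
# Zhang (2022) §16 (16.15): "the constraint `n₁ ∈ 𝔫(𝔮)` can be removed with an acceptable error"
# (`Typed.Section16B.Inline16_nsetRemovable`) — the rough-part sums and the edge

Topic `Literature/NumberTheory/LFunctions/Zhang2022` (Landau–Siegel audit tree; verdict-neutral).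
Y. Zhang, *Discrete mean estimates and the Landau–Siegel zero*, arXiv:2211.02515v1 (2022)
[Zhang2022LandauSiegel] — **an unrefereed manuscript under adjudication**; nothing here bears on its
Theorems 1–2. ZHANG-L discharge lane (WP16, seat zl-w16-p4, helper of zl-w16-p8), node
`Typed.Section16B.Inline16_nsetRemovable c′` (§16 p. 94, tex L4638; the rate is not printed and is read as
the `O(1/𝓛)` of (16.15)). Theorems only; no definitions, no named facts.

* `tau3R_prime_mul_le` — `τ₃(qb) ≤ 3τ₃(b)` (`q` prime, `b ≥ 1`);
* `norm_nu_prime_le_sq` — `|ν(q)| ≤ |ν(q)|²` at a prime (`ν(q) = 1 + χ(q) ∈ {0,1,2}`, `χ` real);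
* `sum_rough_nu_tau3R_div_le` — the `ν`-weighted rough sum, re-indexed by the least prime factor:
  `Σ_{2≤b<N,(b,𝔮)=1} |ν(p(b))|τ₃(b)/b ≤ 3·(Σ_{D⁴<q≤N prime}|ν(q)|²/q)·(Σ_{1≤b'<N,(b',𝔮)=1}τ₃(b')/b')`
  (`p(b) = Nat.minFac b ≥ D⁴`), ready for Lemma 3.1 (`Lemma31.lemma_3_1`: `Σ_{D⁴<h≤P²}|ν(h)|²/h ≪ 𝓛⁻²⁰¹¹`)
  and `sum_rough_tau3R_div_le`.

## References

* Y. Zhang, arXiv:2211.02515v1 (2022), §16 (16.15) p. 94, tex L4634–L4640; §3 Lemma 3.1 p. 7.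
  [cite: Zhang2022LandauSiegel, §16 (16.15) p.94]
-/

noncomputable section

open Real Finset ArithmeticFunction
open scoped ArithmeticFunction.sigma ArithmeticFunction.zeta
open Literature.NumberTheory.LFunctions.Zhang2022
open Literature.NumberTheory.LFunctions.Zhang2022.Skeleton
open Literature.NumberTheory.LFunctions.Zhang2022.SmoothEulerMajorant

namespace Literature.NumberTheory.LFunctions.Zhang2022.Typed.Section16B

/-! ## `τ₃(qb) ≤ 3τ₃(b)` -/

/-- `τ₃ ≥ 0`. [folklore] -/
private theorem tau3R_nonneg'' (n : ℕ) : 0 ≤ tau3R n :=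
  Finset.sum_nonneg fun _ _ => Nat.cast_nonneg _

/-- **`τ₃(qb) ≤ 3τ₃(b)`** for a prime `q` and `b ≥ 1`: write `b = q^a c` with `q ∤ c`; then
`τ₃(q^{a+1}c) = ((a+2)(a+3)/2)τ₃(c) ≤ 3·((a+1)(a+2)/2)τ₃(c) = 3τ₃(b)`.
[cite: Zhang2022LandauSiegel, §16 (16.15) p.94] -/
theorem tau3R_prime_mul_le {q b : ℕ} (hq : q.Prime) (hb : b ≠ 0) : tau3R (q * b) ≤ 3 * tau3R b := by
  -- split off the `q`-part of `b`
  set a := b.factorization q with ha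
  obtain ⟨c, hc⟩ : q ^ a ∣ b := Nat.ordProj_dvd b q
  have hc0 : c ≠ 0 := by rintro rfl; rw [mul_zero] at hc; exact hb hc
  have hqc : ¬ q ∣ c := by
    intro hdvd
    have : q ^ (a + 1) ∣ b := by
      rw [hc, pow_succ]; exact Nat.mul_dvd_mul_left _ hdvd
    have := (Nat.Prime.pow_dvd_iff_le_factorization hq hb).mp this
    omega
  have hcop : Nat.Coprime (q ^ a) c := (Nat.Coprime.pow_left a ((Nat.Prime.coprime_iff_not_dvd hq).mpr hqc))
  have hcop' : Nat.Coprime (q ^ (a + 1)) c :=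
    (Nat.Coprime.pow_left (a + 1) ((Nat.Prime.coprime_iff_not_dvd hq).mpr hqc))
  have hqb : q * b = q ^ (a + 1) * c := by rw [hc, pow_succ]; ring
  rw [hqb, hc, tau3R_mul_of_coprime hcop', tau3R_mul_of_coprime hcop, tau3R_prime_pow hq,
    tau3R_prime_pow hq]
  have hτc := tau3R_nonneg'' c
  have hnum : ((a + 1 : ℕ) + 1 : ℝ) * ((a + 1 : ℕ) + 2) / 2 ≤ 3 * (((a : ℝ) + 1) * (a + 2) / 2) := by
    push_cast; nlinarith [Nat.cast_nonneg (α := ℝ) a]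
  calc ((a + 1 : ℕ) + 1 : ℝ) * ((a + 1 : ℕ) + 2) / 2 * tau3R c
      ≤ 3 * (((a : ℝ) + 1) * (a + 2) / 2) * tau3R c := mul_le_mul_of_nonneg_right hnum hτc
    _ = 3 * (((a : ℝ) + 1) * (a + 2) / 2 * tau3R c) := by ring

/-! ## `|ν(q)| ≤ |ν(q)|²` at primes, for a real character -/

/-- At a prime `q`, `ν(q) = 1 + χ(q) ∈ {0, 1, 2}` for a quadratic `χ`, so `|ν(q)| ≤ |ν(q)|²`.
[cite: Zhang2022LandauSiegel, §3 p.7 (`ν = 1 ∗ χ`)] -/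
theorem norm_nu_prime_le_sq {D : ℕ} [NeZero D] (χ : DirichletCharacter ℂ D) (hq2 : χ.IsQuadratic)
    {q : ℕ} (hq : q.Prime) : ‖nu χ q‖ ≤ ‖nu χ q‖ ^ 2 := by
  rw [Typed.Section15C.nu_prime χ hq]
  rcases hq2 (q : ZMod D) with h | h | h <;> rw [h] <;> norm_num

/-! ## The `ν`-weighted rough sum, re-indexed by the least prime factor -/

open scoped Classical in
/-- **The `ν`-weighted rough sum**: for `2 ≤ D` and `N ≥ 1`,
`Σ_{2≤b<N, (b,𝔮)=1} |ν(p(b))|τ₃(b)/b ≤ 3·(Σ_{q∈(D⁴,N], q prime}|ν(q)|²/q)·(Σ_{1≤b'<N,(b',𝔮)=1}τ₃(b')/b')`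
where `p(b) = Nat.minFac b` (a prime `≥ D⁴`, as `(b,𝔮) = 1`): re-index `b = p(b)·b'` (injective),
`τ₃(p b') ≤ 3τ₃(b')`, `|ν(p)| ≤ |ν(p)|²`. [cite: Zhang2022LandauSiegel, §16 (16.15) p.94] -/
theorem sum_rough_nu_tau3R_div_le {D : ℕ} [NeZero D] (χ : DirichletCharacter ℂ D) (hq2 : χ.IsQuadratic)
    (hD : 2 ≤ D) (N : ℕ) :
    ∑ b ∈ (Finset.Ico 2 N).filter (fun b => Nat.Coprime b (frakq D)),
        ‖nu χ (Nat.minFac b)‖ * tau3R b / b ≤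
      3 * (∑ q ∈ (Finset.Ioc (D ^ 4) N).filter Nat.Prime, ‖nu χ q‖ ^ 2 / q) *
        ∑ b' ∈ (Finset.Ico 1 N).filter (fun b' => Nat.Coprime b' (frakq D)), tau3R b' / b' := by
  set K := frakq D with hK
  set R := (Finset.Ico 2 N).filter (fun b => Nat.Coprime b K) with hR
  set Q := (Finset.Ioc (D ^ 4) N).filter Nat.Prime with hQ
  set R' := (Finset.Ico 1 N).filter (fun b' => Nat.Coprime b' K) with hR'
  -- the map `b ↦ (minFac b, b / minFac b)` sends `R` injectively into `Q × R'`
  set φ : ℕ → ℕ × ℕ := fun b => (Nat.minFac b, b / Nat.minFac b) with hφ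
  have hD4np : ¬ (D ^ 4).Prime := by
    intro h
    have h2 : D ^ 2 ∣ D ^ 4 := pow_dvd_pow D (by norm_num)
    rcases (Nat.dvd_prime h).mp h2 with h1 | h4
    · have : 4 ≤ D ^ 2 := by nlinarith
      omega
    · have hD2 : D ^ 2 < D ^ 4 := Nat.pow_lt_pow_right (by omega) (by norm_num)
      omega
  have key : ∀ b ∈ R, (Nat.minFac b).Prime ∧ Nat.minFac b ∣ b ∧ φ b ∈ Q ×ˢ R' ∧
      Nat.minFac b * (b / Nat.minFac b) = b := by
    intro b hb
    rw [hR, Finset.mem_filter, Finset.mem_Ico] at hb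
    obtain ⟨⟨hb2, hbN⟩, hcop⟩ := hb
    have hb1 : b ≠ 1 := by omega
    have hpm : (Nat.minFac b).Prime := Nat.minFac_prime hb1
    have hpd : Nat.minFac b ∣ b := Nat.minFac_dvd b
    have hpcop : Nat.Coprime (Nat.minFac b) K := Nat.Coprime.coprime_dvd_left hpd hcop
    have hpK : ¬ Nat.minFac b ∣ K := fun h =>
      hpm.one_lt.ne' (Nat.Coprime.eq_one_of_dvd hpcop h)
    have hpge : D ^ 4 ≤ Nat.minFac b := by
      by_contra hlt
      exact hpK ((prime_dvd_frakq_iff hpm).mpr (not_le.mp hlt))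
    have hpgt : D ^ 4 < Nat.minFac b := by
      rcases hpge.eq_or_lt with h | h
      · exact absurd (h ▸ hpm) hD4np
      · exact h
    have hple : Nat.minFac b ≤ b := Nat.minFac_le (by omega)
    have hmul : Nat.minFac b * (b / Nat.minFac b) = b := Nat.mul_div_cancel' hpd
    have hb'1 : 1 ≤ b / Nat.minFac b := Nat.div_pos hple hpm.pos
    have hb'le : b / Nat.minFac b ≤ b := Nat.div_le_self b _
    have hb'cop : Nat.Coprime (b / Nat.minFac b) K :=
      Nat.Coprime.coprime_dvd_left (Nat.div_dvd_of_dvd hpd) hcop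
    refine ⟨hpm, hpd, ?_, hmul⟩
    simp only [hφ, Finset.mem_product, hQ, hR', Finset.mem_filter, Finset.mem_Ioc, Finset.mem_Ico]
    exact ⟨⟨⟨hpgt, hple.trans hbN.le⟩, hpm⟩, ⟨⟨hb'1, lt_of_le_of_lt hb'le hbN⟩, hb'cop⟩⟩
  have hinj : Set.InjOn φ ↑R := by
    intro b₁ hb₁ b₂ hb₂ heq
    have e₁ := (key b₁ hb₁).2.2.2
    have e₂ := (key b₂ hb₂).2.2.2
    simp only [hφ, Prod.mk.injEq] at heq
    obtain ⟨h1, h2⟩ := heq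
    calc b₁ = Nat.minFac b₁ * (b₁ / Nat.minFac b₁) := e₁.symm
      _ = Nat.minFac b₂ * (b₂ / Nat.minFac b₂) := by rw [h2, h1]
      _ = b₂ := e₂
  -- termwise comparison with `G(p,b') = 3(|ν(p)|²/p)(τ₃(b')/b')`
  set G : ℕ × ℕ → ℝ := fun x => 3 * (‖nu χ x.1‖ ^ 2 / x.1) * (tau3R x.2 / x.2) with hG
  have hG0 : ∀ x, 0 ≤ G x := fun x => by
    rw [hG]; have := tau3R_nonneg'' x.2; positivity
  have hterm : ∀ b ∈ R, ‖nu χ (Nat.minFac b)‖ * tau3R b / b ≤ G (φ b) := by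
    intro b hb
    obtain ⟨hpm, hpd, -, hmul⟩ := key b hb
    set p := Nat.minFac b with hp
    set b' := b / Nat.minFac b with hb'
    have hb0 : b ≠ 0 := by
      have := (Finset.mem_Ico.mp (Finset.mem_filter.mp hb).1).1; omega
    have hb'0 : b' ≠ 0 := by rintro h0; rw [h0, mul_zero] at hmul; exact hb0 hmul.symm
    have hp0 : (0 : ℝ) < p := by exact_mod_cast hpm.pos
    have hb'pos : (0 : ℝ) < b' := by exact_mod_cast Nat.pos_of_ne_zero hb'0
    have hτ : tau3R b ≤ 3 * tau3R b' := by
      rw [← hmul]; exact tau3R_prime_mul_le hpm hb'0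
    have hν := norm_nu_prime_le_sq χ hq2 hpm
    have hbR : (b : ℝ) = p * b' := by rw [← hmul]; push_cast; rfl
    simp only [hG, hφ]
    rw [hbR]
    rw [show ‖nu χ p‖ * tau3R b / (↑p * ↑b') = (‖nu χ p‖ / p) * (tau3R b / b') by
      field_simp]
    have h1 : ‖nu χ p‖ / p ≤ ‖nu χ p‖ ^ 2 / p := div_le_div_of_nonneg_right hν hp0.le
    have h2 : tau3R b / b' ≤ 3 * tau3R b' / b' := div_le_div_of_nonneg_right hτ hb'pos.le
    have h1' : 0 ≤ ‖nu χ p‖ ^ 2 / p := by positivity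
    have h2' : 0 ≤ tau3R b / b' := div_nonneg (tau3R_nonneg'' b) hb'pos.le
    calc ‖nu χ p‖ / ↑p * (tau3R b / ↑b') ≤ ‖nu χ p‖ ^ 2 / p * (3 * tau3R b' / b') :=
          mul_le_mul h1 h2 h2' h1'
      _ = 3 * (‖nu χ p‖ ^ 2 / p) * (tau3R b' / b') := by ring
  have himg : R.image φ ⊆ Q ×ˢ R' := by
    intro x hx
    obtain ⟨b, hb, rfl⟩ := Finset.mem_image.mp hx
    exact (key b hb).2.2.1
  calc ∑ b ∈ R, ‖nu χ (Nat.minFac b)‖ * tau3R b / b ≤ ∑ b ∈ R, G (φ b) := Finset.sum_le_sum hterm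
    _ = ∑ x ∈ R.image φ, G x := (Finset.sum_image hinj).symm
    _ ≤ ∑ x ∈ Q ×ˢ R', G x := Finset.sum_le_sum_of_subset_of_nonneg himg fun x _ _ => hG0 x
    _ = ∑ q ∈ Q, ∑ b' ∈ R', G (q, b') := Finset.sum_product _ _ _
    _ = ∑ q ∈ Q, (3 * (‖nu χ q‖ ^ 2 / q)) * ∑ b' ∈ R', tau3R b' / b' := by
        refine Finset.sum_congr rfl fun q _ => ?_
        rw [Finset.mul_sum]
    _ = 3 * (∑ q ∈ Q, ‖nu χ q‖ ^ 2 / q) * ∑ b' ∈ R', tau3R b' / b' := by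
        rw [mul_assoc, Finset.sum_mul, Finset.mul_sum]
        exact Finset.sum_congr rfl fun q _ => by ring

end Literature.NumberTheory.LFunctions.Zhang2022.Typed.Section16B

end
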